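import Summits.CriticalPhenomena.PercolationContinuityZ3.Theorems.FK.LocalEventInterlacing
import Summits.CriticalPhenomena.PercolationContinuityZ3.Theorems.FK.ClusterSizeLocality
import HarnessLib

/-!
# FK-continuity cell, FO-10a: the cluster density `κ^b(p,q) = φ^b_{p,q}(|C_x|⁻¹)` is one-sidedly continuous in `p`,
# `κ⁰(p+) = κ¹(p)`, `κ¹(p−) = κ⁰(p)`, and `κ⁰(·,q)` is continuous at `p` iff `κ⁰(p,q) = κ¹(p,q)`
# (Grimmett 2006, Thm. (4.63)(b)-type statement for the order parameter conjugate to `q`, via Prop. (4.28))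

Registered R82 (cell INBOX l.5940, 2026-08-24); registry row FO-10a-g337p; label PCT-D (coordinator fk-4 g175).
Cell `fk-continuity` (bschramm), row FO-10a (domain-Markov + comparison layer over FO-06); support file for the
FK-continuity transplant (`--supports stmt-CriticalPhenomena-4575`); builds on p205010 (kernel theorem, internal audit
signed; external expert review pending). Pure proofs; no definitions, no named facts, no sorries; general `d`.

`|C_x|⁻¹` (Lean: `((openCluster ω x).ncard : ℝ)⁻¹`, `= 0` on an infinite cluster) is NOT a local function, so the local
one-sided continuity of row FO-10a-g335s does not apply directly. It is the uniform limit (error `≤ 1/N`) of the local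
decreasing functions `1/min(|C_x|, N) = 1 − Σ_{k=2}^{N} 1{|C_x| ≥ k}/(k(k−1))`, the events `{|C_x| ≥ k}` (Literature
`clusterSizeGe`, `encard`-valued) being increasing and — on lattice configurations, which carry every measure in sight — LOCAL (`le_encard_openCluster_inter_edgesIn_iff`:
decided by the edges of the box `Λ_{m+k}` when `x ∈ Λ_m` — a cluster with `≥ k` vertices contains a connected `k`-set through `x` inside that
box, found by adding one open lattice edge at a time). So `κ^b(p) = 1 − Σ_{k≥2} φ^b_p(|C_x| ≥ k)/(k(k−1))` inherits, uniformly in `N`, the one-sided continuity and the cross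
limits of `LocalEventInterlacing.lean`.

* (tools in `ClusterSizeLocality.lean`: the local proxy `le_encard_openCluster_inter_edgesIn_iff` of `{|C_x| ≥ k}` and the uniform
  bound `abs_integral_inv_ncard_sub_le`);
* `determinedBy_le_encard_openCluster_inter`, `isUpperSet_le_encard_openCluster_inter`, `measureReal_clusterSizeGe_eq_of_ae_subset`
  (the local proxy of `{|C_x| ≥ k}` is an increasing local event with the same probability under lattice-carried measures);
* `tendsto_of_forall_eventually_approx`, **`tendsto_integral_inv_ncard_rcLimit_of_forall_local`** (parameter-limits transfer from
  increasing local events to `κ`);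
* `integral_inv_ncard_rcLimit_anti` — **`κ^b(·,q)` is non-increasing in `p`** (Prop. (4.28)(a) through the proxies);
* **`tendsto_integral_inv_ncard_rcLimit_false_nhdsGT`** — `κ⁰(t) → κ¹(p)` as `t ↓ p`; **`tendsto_integral_inv_ncard_rcLimit_true_nhdsLT`** —
  `κ¹(t) → κ⁰(p)` as `t ↑ p`; `tendsto_integral_inv_ncard_rcLimit_false_nhdsLT` (κ⁰ left-continuous),
  `tendsto_integral_inv_ncard_rcLimit_true_nhdsGT` (κ¹ right-continuous);
* HEADLINES **`continuousAt_integral_inv_ncard_rcLimit_false_iff (hd : 0 < d) (hq : 1 ≤ q) (hp : p ∈ Ioo 0 1) (x) :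
  ContinuousAt (fun t => ∫ ω, ((openCluster ω x).ncard : ℝ)⁻¹ ∂(rcLimit d false t q)) p ↔ κ⁰(p) = κ¹(p)`** and
  `continuousAt_integral_inv_ncard_rcLimit_true_iff` (with row FO-10a-g337's `rcLimit_false_eq_rcLimit_true_iff_integral_inv_ncard_eq`,
  not imported here: iff `φ⁰_{p,q} = φ¹_{p,q}` — the cluster density is continuous in `p` exactly off `𝒟_q`).

Honest framing: UNCONDITIONAL structure; NOT a binder discharge, NOT `_r4`; `_r3` « 2 / 0 ☑ », n_open = 2 unchanged.

## References

* G. Grimmett, *The Random-Cluster Model*, Springer 2006 (`book:grimmett2006-random-cluster-model`): Prop. (4.28) [PDF p. 80],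
  Thm. (4.63), (4.84), Lemma (4.79), Prop. (4.85) [PDF pp. 89–95]. [Grimmett2006]
-/

noncomputable section

open MeasureTheory Set Filter
open scoped Topology ENNReal

namespace Summit.CriticalPhenomena.PercolationContinuityZ3.Theorems.FK

open Literature.Probability.Percolation Literature.Probability.LatticeModels

variable {d : ℕ}

/-! ### One-sided continuity and cross limits of `κ^b(·,q)` -/

section Continuity

/-- Approximation transfer: if `F` is, along `l`, eventually within `ε` of functions converging to within `ε` of `L`,
for every `ε > 0`, then `F → L` along `l`. [folklore] -/
theorem tendsto_of_forall_eventually_approx {α : Type*} {l : Filter α} {F : α → ℝ} {L : ℝ}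
    (h : ∀ ε > 0, ∃ G : α → ℝ, ∃ M : ℝ, Tendsto G l (𝓝 M) ∧ (∀ᶠ t in l, |F t - G t| ≤ ε) ∧ |L - M| ≤ ε) :
    Tendsto F l (𝓝 L) := by
  rw [Metric.tendsto_nhds]
  intro ε hε
  obtain ⟨G, M, hG, hFG, hLM⟩ := h (ε / 3) (by positivity)
  filter_upwards [hFG, (Metric.tendsto_nhds.1 hG) (ε / 3) (by positivity)] with t h1 h2
  rw [Real.dist_eq] at h2 ⊢
  calc |F t - L| = |(F t - G t) + (G t - M) + (M - L)| := by ring_nf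
    _ ≤ |F t - G t| + |G t - M| + |M - L| := abs_add_three _ _ _
    _ < ε := by rw [abs_sub_comm M L]; linarith

variable {p q : ℝ}

/-- The LOCAL proxy for `{|C_x| ≥ k}`: `k ≤ |C_x(ω ∩ E_{Λ_{m+k}})|` is determined by the edges of `Λ_{m+k}`. [folklore] -/
theorem determinedBy_le_encard_openCluster_inter (x : Site d) (m k : ℕ) :
    DeterminedBy {ω : BondConfig (Site d) |
        (k : ℕ∞) ≤ (openCluster (ω ∩ ↑(edgesIn (zdGraph d) (box d (m + k)))) x).encard}
      ↑(edgesIn (zdGraph d) (box d (m + k))) := by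
  rw [determinedBy_iff]
  intro ω ω' h
  simp only [Set.mem_setOf_eq, h]

/-- The local proxy is increasing. [folklore] -/
theorem isUpperSet_le_encard_openCluster_inter (x : Site d) (m k : ℕ) :
    IsUpperSet {ω : BondConfig (Site d) |
        (k : ℕ∞) ≤ (openCluster (ω ∩ ↑(edgesIn (zdGraph d) (box d (m + k)))) x).encard} :=
  fun _ _ hle hω => le_trans hω (Set.encard_le_encard (openCluster_mono (Set.inter_subset_inter_left _ hle) x))

/-- Under a lattice-carried measure the local proxy has the probability of `{|C_x| ≥ k}` (`x ∈ Λ_m`). [folklore] -/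
theorem measureReal_clusterSizeGe_eq_of_ae_subset {P : Measure (BondConfig (Site d))}
    (hP : ∀ᵐ ω ∂P, ω ⊆ (zdGraph d).edgeSet) {x : Site d} {m : ℕ} (hx : x ∈ box d m) (k : ℕ) :
    P.real (clusterSizeGe x k) =
      P.real {ω | (k : ℕ∞) ≤ (openCluster (ω ∩ ↑(edgesIn (zdGraph d) (box d (m + k)))) x).encard} := by
  refine measureReal_congr (hP.mono fun ω hω => ?_)
  change (ω ∈ clusterSizeGe x k) = (ω ∈ {ω | (k : ℕ∞) ≤ (openCluster (ω ∩ ↑(edgesIn (zdGraph d) (box d (m + k)))) x).encard})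
  rw [mem_clusterSizeGe, Set.mem_setOf_eq, le_encard_openCluster_inter_edgesIn_iff hω hx]

/-- **Transfer of parameter-limits from increasing local events to the cluster density.** If along a filter `l` of
parameters (eventually inside `[0,1]`) every increasing local probability `φ^b_t(A)` tends to `φ^{b'}_p(A)`, then
`κ^b(t) = ∫ |C_x|⁻¹ dφ^b_t → κ^{b'}(p)` — by the uniform `1/N` approximation of `|C_x|⁻¹` through the local proxies of
`{|C_x| ≥ k}`. [cite: Grimmett2006, Prop. (4.28) with (4.84)] -/
theorem tendsto_integral_inv_ncard_rcLimit_of_forall_local (hq : 1 ≤ q) (x : Site d) {b b' : Bool} {l : Filter ℝ}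
    (hp : p ∈ Set.Icc (0 : ℝ) 1) (hl : ∀ᶠ t in l, t ∈ Set.Icc (0 : ℝ) 1)
    (hloc : ∀ (A : Set (BondConfig (Site d))) (F : Finset (Sym2 (Site d))), IsUpperSet A → DeterminedBy A ↑F →
      Tendsto (fun t : ℝ => (rcLimit d b t q).real A) l (𝓝 ((rcLimit d b' p q).real A))) :
    Tendsto (fun t : ℝ => ∫ ω, ((openCluster ω x).ncard : ℝ)⁻¹ ∂(rcLimit d b t q)) l
      (𝓝 (∫ ω, ((openCluster ω x).ncard : ℝ)⁻¹ ∂(rcLimit d b' p q))) := by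
  have hq0 : 0 < q := one_pos.trans_le hq
  set m := siteRad x with hm
  have hxm : x ∈ box d m := mem_box_iff_siteRad_le.2 le_rfl
  set B : ℕ → Set (BondConfig (Site d)) := fun k =>
    {ω | (k : ℕ∞) ≤ (openCluster (ω ∩ ↑(edgesIn (zdGraph d) (box d (m + k)))) x).encard} with hB
  have hBeq : ∀ (c : Bool) {t : ℝ}, t ∈ Set.Icc (0 : ℝ) 1 → ∀ k,
      (rcLimit d c t q).real (clusterSizeGe x k) = (rcLimit d c t q).real (B k) := fun c t ht k =>
    measureReal_clusterSizeGe_eq_of_ae_subset ((isBoxLimit_rcLimit c ht hq).ae_subset_edgeSet ht hq0) hxm k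
  refine tendsto_of_forall_eventually_approx fun ε hε => ?_
  obtain ⟨N, hN⟩ := exists_nat_one_div_lt hε
  have hN1 : (1 : ℝ) / ((N + 1 : ℕ) : ℝ) ≤ ε := by push_cast; exact hN.le
  refine ⟨fun t => 1 - ∑ k ∈ Finset.Icc 2 (N + 1), (rcLimit d b t q).real (B k) / (((k : ℝ) - 1) * k),
    1 - ∑ k ∈ Finset.Icc 2 (N + 1), (rcLimit d b' p q).real (B k) / (((k : ℝ) - 1) * k), ?_, ?_, ?_⟩
  · refine tendsto_const_nhds.sub (tendsto_finsetSum _ fun k _ => ?_)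
    exact (hloc _ _ (isUpperSet_le_encard_openCluster_inter x m k) (determinedBy_le_encard_openCluster_inter x m k)).div_const _
  · filter_upwards [hl] with t htI
    haveI := isProbabilityMeasure_rcLimit b t q (d := d)
    have h := abs_integral_inv_ncard_sub_le (rcLimit d b t q) x (N + 1) (by omega)
    simp_rw [hBeq b htI] at h
    exact h.trans hN1
  · haveI := isProbabilityMeasure_rcLimit b' p q (d := d)
    have h := abs_integral_inv_ncard_sub_le (rcLimit d b' p q) x (N + 1) (by omega)
    simp_rw [hBeq b' hp] at h
    exact h.trans hN1

/-- **`κ^b(·,q)` is non-increasing in `p` on `[0,1]`** (`q ≥ 1`): `|C_x|⁻¹` is a decreasing functional and `φ^b_{p,q}` increases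
with `p` (Prop. (4.28)(a)) — through the local proxies and the uniform `1/N` approximation. [cite: Grimmett2006, Prop. (4.28)(a) with (4.84)] -/
theorem integral_inv_ncard_rcLimit_anti (b : Bool) (hq : 1 ≤ q) (x : Site d) {s t : ℝ} (hs : s ∈ Set.Icc (0 : ℝ) 1)
    (ht : t ∈ Set.Icc (0 : ℝ) 1) (hst : s ≤ t) :
    ∫ ω, ((openCluster ω x).ncard : ℝ)⁻¹ ∂(rcLimit d b t q) ≤ ∫ ω, ((openCluster ω x).ncard : ℝ)⁻¹ ∂(rcLimit d b s q) := by
  have hq0 : 0 < q := one_pos.trans_le hq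
  set m := siteRad x with hm
  have hxm : x ∈ box d m := mem_box_iff_siteRad_le.2 le_rfl
  set B : ℕ → Set (BondConfig (Site d)) := fun k =>
    {ω | (k : ℕ∞) ≤ (openCluster (ω ∩ ↑(edgesIn (zdGraph d) (box d (m + k)))) x).encard} with hB
  have hBeq : ∀ {u : ℝ}, u ∈ Set.Icc (0 : ℝ) 1 → ∀ k,
      (rcLimit d b u q).real (clusterSizeGe x k) = (rcLimit d b u q).real (B k) := fun hu k =>
    measureReal_clusterSizeGe_eq_of_ae_subset ((isBoxLimit_rcLimit b hu hq).ae_subset_edgeSet hu hq0) hxm k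
  -- the approximants are ordered, term by term
  have hG : ∀ N : ℕ, 1 ≤ N →
      (1 - ∑ k ∈ Finset.Icc 2 N, (rcLimit d b t q).real (B k) / (((k : ℝ) - 1) * k)) ≤
        1 - ∑ k ∈ Finset.Icc 2 N, (rcLimit d b s q).real (B k) / (((k : ℝ) - 1) * k) := by
    intro N _
    refine sub_le_sub_left (Finset.sum_le_sum fun k hk => ?_) 1
    have hk2 : (2 : ℕ) ≤ k := (Finset.mem_Icc.1 hk).1
    have hden : 0 < ((k : ℝ) - 1) * k := by
      have : (2 : ℝ) ≤ k := by exact_mod_cast hk2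
      nlinarith
    exact div_le_div_of_nonneg_right (rcLimit_real_mono_left b (exists_isBoxLimit b hs hq) (exists_isBoxLimit b ht hq) hs ht
      hst hq (isUpperSet_le_encard_openCluster_inter x m k) (determinedBy_le_encard_openCluster_inter x m k)) hden.le
  haveI := isProbabilityMeasure_rcLimit b t q (d := d)
  haveI := isProbabilityMeasure_rcLimit b s q (d := d)
  refine le_of_forall_pos_lt_add fun ε hε => ?_
  obtain ⟨N, hN⟩ := exists_nat_one_div_lt (half_pos hε)
  have hN1 : (1 : ℝ) / ((N + 1 : ℕ) : ℝ) < ε / 2 := by push_cast; exact hN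
  have h1 := abs_integral_inv_ncard_sub_le (rcLimit d b t q) x (N + 1) (by omega)
  have h2 := abs_integral_inv_ncard_sub_le (rcLimit d b s q) x (N + 1) (by omega)
  simp_rw [hBeq ht] at h1
  simp_rw [hBeq hs] at h2
  have h3 := hG (N + 1) (by omega)
  rw [abs_le] at h1 h2
  linarith [h1.2, h2.1]

/-- **`κ⁰(t) → κ¹(p)` as `t ↓ p`: the right limit of the free cluster density is the wired one** (`d ≥ 1`, `0 ≤ p < 1`,
`q ≥ 1`, any site). [cite: Grimmett2006, Thm. (4.63) (proof, (4.77)–(4.78)) with Prop. (4.28)(b), read on (4.84)'s observable] -/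
theorem tendsto_integral_inv_ncard_rcLimit_false_nhdsGT (hd : 0 < d) (hq : 1 ≤ q) (hp : p ∈ Set.Ico (0 : ℝ) 1)
    (x : Site d) :
    Tendsto (fun t : ℝ => ∫ ω, ((openCluster ω x).ncard : ℝ)⁻¹ ∂(rcLimit d false t q)) (𝓝[>] p)
      (𝓝 (∫ ω, ((openCluster ω x).ncard : ℝ)⁻¹ ∂(rcLimit d true p q))) :=
  tendsto_integral_inv_ncard_rcLimit_of_forall_local hq x ⟨hp.1, hp.2.le⟩
    (by filter_upwards [Ioo_mem_nhdsGT hp.2] with t ht; exact ⟨hp.1.trans ht.1.le, ht.2.le⟩)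
    fun _ _ hAu hA => tendsto_rcLimit_false_real_nhdsGT_of_determinedBy hd hq hA hAu hp

/-- **`κ¹(t) → κ⁰(p)` as `t ↑ p`: the left limit of the wired cluster density is the free one** (`0 < p ≤ 1`, `q ≥ 1`).
[cite: Grimmett2006, Thm. (4.63) (proof, (4.77)–(4.78)) with Prop. (4.28)(c)] -/
theorem tendsto_integral_inv_ncard_rcLimit_true_nhdsLT (hq : 1 ≤ q) (hp : p ∈ Set.Ioc (0 : ℝ) 1) (x : Site d) :
    Tendsto (fun t : ℝ => ∫ ω, ((openCluster ω x).ncard : ℝ)⁻¹ ∂(rcLimit d true t q)) (𝓝[<] p)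
      (𝓝 (∫ ω, ((openCluster ω x).ncard : ℝ)⁻¹ ∂(rcLimit d false p q))) :=
  tendsto_integral_inv_ncard_rcLimit_of_forall_local hq x ⟨hp.1.le, hp.2⟩
    (by filter_upwards [Ioo_mem_nhdsLT hp.1] with t ht; exact ⟨ht.1.le, ht.2.le.trans hp.2⟩)
    fun _ _ hAu hA => tendsto_rcLimit_true_real_nhdsLT_of_determinedBy hq hA hAu hp

/-- **`κ⁰(·,q)` is left-continuous** (`0 < p ≤ 1`, `q ≥ 1`). [cite: Grimmett2006, Prop. (4.28)(c) with (4.84)] -/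
theorem tendsto_integral_inv_ncard_rcLimit_false_nhdsLT (hq : 1 ≤ q) (hp : p ∈ Set.Ioc (0 : ℝ) 1) (x : Site d) :
    Tendsto (fun t : ℝ => ∫ ω, ((openCluster ω x).ncard : ℝ)⁻¹ ∂(rcLimit d false t q)) (𝓝[<] p)
      (𝓝 (∫ ω, ((openCluster ω x).ncard : ℝ)⁻¹ ∂(rcLimit d false p q))) :=
  tendsto_integral_inv_ncard_rcLimit_of_forall_local hq x ⟨hp.1.le, hp.2⟩
    (by filter_upwards [Ioo_mem_nhdsLT hp.1] with t ht; exact ⟨ht.1.le, ht.2.le.trans hp.2⟩)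
    fun _ _ hAu hA => tendsto_rcLimit_false_real_nhdsLT hq hA hAu hp

/-- **`κ¹(·,q)` is right-continuous** (`d ≥ 1`, `0 ≤ p < 1`, `q ≥ 1`). [cite: Grimmett2006, Prop. (4.28)(b) with (4.84)] -/
theorem tendsto_integral_inv_ncard_rcLimit_true_nhdsGT (hd : 0 < d) (hq : 1 ≤ q) (hp : p ∈ Set.Ico (0 : ℝ) 1)
    (x : Site d) :
    Tendsto (fun t : ℝ => ∫ ω, ((openCluster ω x).ncard : ℝ)⁻¹ ∂(rcLimit d true t q)) (𝓝[>] p)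
      (𝓝 (∫ ω, ((openCluster ω x).ncard : ℝ)⁻¹ ∂(rcLimit d true p q))) :=
  tendsto_integral_inv_ncard_rcLimit_of_forall_local hq x ⟨hp.1, hp.2.le⟩
    (by filter_upwards [Ioo_mem_nhdsGT hp.2] with t ht; exact ⟨hp.1.trans ht.1.le, ht.2.le⟩)
    fun _ _ hAu hA => tendsto_rcLimit_true_real_nhdsGT hd hq hA hAu hp

/-- **`κ⁰(·,q)` is continuous at `p ∈ (0,1)` iff `κ⁰(p,q) = κ¹(p,q)`** (`d ≥ 1`, `q ≥ 1`): left-continuous with right limit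
`κ¹(p)`. [cite: Grimmett2006, Thm. (4.63)(b)-type statement for (4.84)'s observable; Lemma (4.79)] -/
theorem continuousAt_integral_inv_ncard_rcLimit_false_iff (hd : 0 < d) (hq : 1 ≤ q) (hp : p ∈ Set.Ioo (0 : ℝ) 1)
    (x : Site d) :
    ContinuousAt (fun t : ℝ => ∫ ω, ((openCluster ω x).ncard : ℝ)⁻¹ ∂(rcLimit d false t q)) p ↔
      ∫ ω, ((openCluster ω x).ncard : ℝ)⁻¹ ∂(rcLimit d false p q) =
        ∫ ω, ((openCluster ω x).ncard : ℝ)⁻¹ ∂(rcLimit d true p q) := by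
  have hright := tendsto_integral_inv_ncard_rcLimit_false_nhdsGT hd hq ⟨hp.1.le, hp.2⟩ x
  constructor
  · intro hc
    exact tendsto_nhds_unique (hc.tendsto.mono_left nhdsWithin_le_nhds) hright
  · intro heq
    rw [continuousAt_iff_continuous_left'_right']
    refine ⟨tendsto_integral_inv_ncard_rcLimit_false_nhdsLT hq ⟨hp.1, hp.2.le⟩ x, ?_⟩
    rw [ContinuousWithinAt, heq]
    exact hright

/-- **`κ¹(·,q)` is continuous at `p ∈ (0,1)` iff `κ⁰(p,q) = κ¹(p,q)`** (`d ≥ 1`, `q ≥ 1`): right-continuous with left limit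
`κ⁰(p)`. [cite: Grimmett2006, Thm. (4.63)(b)-type statement for (4.84)'s observable; Lemma (4.79)] -/
theorem continuousAt_integral_inv_ncard_rcLimit_true_iff (hd : 0 < d) (hq : 1 ≤ q) (hp : p ∈ Set.Ioo (0 : ℝ) 1)
    (x : Site d) :
    ContinuousAt (fun t : ℝ => ∫ ω, ((openCluster ω x).ncard : ℝ)⁻¹ ∂(rcLimit d true t q)) p ↔
      ∫ ω, ((openCluster ω x).ncard : ℝ)⁻¹ ∂(rcLimit d false p q) =
        ∫ ω, ((openCluster ω x).ncard : ℝ)⁻¹ ∂(rcLimit d true p q) := by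
  have hleft := tendsto_integral_inv_ncard_rcLimit_true_nhdsLT hq ⟨hp.1, hp.2.le⟩ x
  constructor
  · intro hc
    exact (tendsto_nhds_unique (hc.tendsto.mono_left nhdsWithin_le_nhds) hleft).symm
  · intro heq
    rw [continuousAt_iff_continuous_left'_right']
    refine ⟨?_, tendsto_integral_inv_ncard_rcLimit_true_nhdsGT hd hq ⟨hp.1.le, hp.2⟩ x⟩
    rw [ContinuousWithinAt, ← heq]
    exact hleft

end Continuity

end Summit.CriticalPhenomena.PercolationContinuityZ3.Theorems.FK

end
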